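import Literature.NumberTheory.Rogawski1990.ArchQuotientHSBallVolumeProduct   -- ★ p849029 (LH3-p01): abstract §1 `measure_setOf_descConj_le_of_pi_marginal_growth`; brings ★ `ArchHSBallVolumeProduct` §1, ★ `archPiEquivCM`, ★ `archLocal` instances
import Literature.NumberTheory.Automorphic.ArchHSGLLowerBound                -- ★ p848738 (LH2-p02): `card_le_sum_normSq_of_conjTranspose_mul_mul_eq`, `det_map_embedding_ne_zero`
import HarnessLib

/-!
# «Places multiply» for `G_∞ = U(J)(L⁺ ⊗ ℝ) ≅ Π_w U(J)_w`: orbit HS-ball growth on `U(J)_∞ ⧸ Z(γ)` (any invariant measure) and Haar HS-ball growth on `U(J)_∞`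
# from per-place bounds (Beuzart-Plessis, Astérisque 418 (2020), §1.5 (1.5.2)–(1.5.3) p. 31; Folland (1995) Thm. 2.49; Gelbart (1975) p. 155 (10.19))

Topic `NumberTheory/Rogawski1990`; namespace `Literature.NumberTheory.Rogawski1990`.  THEOREMS ONLY (no `def`, no instance, no notation, no axiom, no named fact,
no `sorry`).  Cell `pub/hodgecm-mathlib`, crux H413 (`stmt-HodgeConjecture-24833`); the `G_∞`-TWIN (LH2-plan (g0)'s «(Π′)») of ★ `ArchQuotientHSBallVolumeProduct` §4 (LH3,
`H_∞`) and of ★ `ArchHSBallVolumeProduct` §2 (LH3-p03, `H_∞`): the unitary group `U(J)(L⁺ ⊗ ℝ)` of ANY form `J` in ANY rank `N` over a CM field `L` (★ `UnitaryGroup.arch`) is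
`≅ Π_w U(σ_w J)(ℂ)` over the complex places (★ `archPiEquivCM N L J`, a `≃ₜ*`), with NO compact factor, so the abstract finite-product step applies directly.  Count-neutral
measure-theoretic plumbing behind (CONV) for the carriers `G_∞ = U(Φ₃)(L⁺ ⊗ ℝ)` and `G′_∞ = U(H)(L⁺ ⊗ ℝ)` of the LH2∕LH3 letters; pays no organ by itself.

* §1 `measure_setOf_descConj_prod_place_le_of_marginal_growth_arch` — QUOTIENT SIDE: for `γ ∈ U(J)_∞`, ANY `U(J)_∞`-invariant measure `μ` on `U(J)_∞ ⧸ Z(γ)` finite on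
  compact sets, ANY ONE non-zero invariant σ-finite `μ_w` per place on `U(J)_w ⧸ Z_w(γ_w)` finite on compact sets with `μ_w{ȳ ∣ F_w(ȳ γ_w ȳ⁻¹) ≤ ρ} ≤ C ρ^a` (`F_w ≥ 1`):
  `μ{ȳ ∣ ∏_w F_w((ȳ γ ȳ⁻¹)_w) ≤ R} ≤ A R^a (1 + log R)^m` (★ abstract `measure_setOf_descConj_le_of_pi_marginal_growth` at `e = archPiEquivCM⁻¹`).
* §1 **`measure_setOf_descConj_archHSGL_arch_le`** — its Hilbert–Schmidt reading `archHSGL(ȳ γ ȳ⁻¹) = ∏_w ‖(ȳ γ ȳ⁻¹)_w‖²_HS` = the `hvol` binder of ★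
  `integrable_orbitalIntegrand_of_archSchwartzOn_of_volumeGrowth` ∕ `integrable_descConj_of_archSchwartzOn_of_volumeGrowth` (★ `ArchSchwartzOrbitalIntegralConvergenceGeneric`,
  LH2-p02) TOKEN FOR TOKEN (`N ≥ 1`, `det J ≠ 0` for `‖·_w‖²_HS ≥ N ≥ 1`, ★ `card_le_sum_normSq_of_conjTranspose_mul_mul_eq`).
* §2 `haar_setOf_prod_place_le_of_marginal_growth_arch`, **`haar_setOf_archHSGL_arch_le`** — GROUP SIDE: for ANY Haar measure `ν_G` on `U(J)_∞` and per-place functions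
  `F_w ≥ 1` with `ν{F_w ≤ ρ} ≤ C ρ^a` for every Haar `ν` on `U(J)_w`: `ν_G{k ∣ ∏_w F_w(k_w) ≤ R} ≤ A R^a (1 + log R)^m` (Haar uniqueness `isMulLeftInvariant_eq_smul` along
  ★ `archPiEquivCM`, product Haar = Haar, ★ `exists_pi_measure_setOf_prod_le_of_marginal_growth`), and the HS reading.
HONEST LABEL: HC_CM is proved only modulo the 7 printed citations (2 remaining: hLiu418 = `stmt-HodgeConjecture-24832`, h413 = `stmt-HodgeConjecture-24833`) until rung 0 closes;
this file is count-neutral kit.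

## References
* [BeuzartPlessis2020Asterisque] R. Beuzart-Plessis, Astérisque 418 (2020), §1.2 pp. 19–21 (norms), §1.5 (1.5.2)–(1.5.3) p. 31 (growth of weighted balls; convergence of Schwartz orbital integrals).
* [Folland1995] G. B. Folland, *A Course in Abstract Harmonic Analysis* (1995), §2.6 Thm. 2.49 (uniqueness of invariant measures on `G ⧸ H`; Haar uniqueness).
* [Gelbart1975] S. Gelbart, Ann. of Math. Stud. 83 (1975), p. 155 (10.19) (orbital integrals factor over places).
* [PlatonovRapinchuk1994] V. Platonov, A. Rapinchuk, *Algebraic Groups and Number Theory* (1994), §2.3, §3.2 (`G(K ⊗ ℝ) = Π_v G(K_v)`).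
-/

set_option autoImplicit false

noncomputable section

open MeasureTheory MeasureTheory.Measure NumberField NumberField.InfinitePlace NumberField.mixedEmbedding
open Literature.MeasureTheory.Group
open Literature.NumberTheory.Automorphic Literature.NumberTheory.Automorphic.UnitaryGroup
open scoped ENNReal NNReal MatrixGroups Classical ComplexOrder

namespace Literature.NumberTheory.Rogawski1990

/-! ## §1 The quotient side on `U(J)(L⁺ ⊗ ℝ) ⧸ Z(γ)` -/

section Quotient

variable (L : Type) [Field L] [NumberField L] [IsCMField L] (N : ℕ) (J : Matrix (Fin N) (Fin N) L)

/-- **«PLACES MULTIPLY» FOR ORBIT BALLS ON `U(J)_∞ ⧸ Z(γ)` (any invariant measure, any per-place radii `F_w ≥ 1`).**  Let `γ ∈ U(J)(L⁺ ⊗ ℝ)`, `γ_w := (archPiEquivCM … γ)_w`,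
`μ` ANY `U(J)_∞`-invariant measure on `U(J)_∞ ⧸ Z(γ)` finite on compact sets, and per complex place `w` let `μ_w` be ANY ONE non-zero `U(J)_w`-invariant σ-finite measure on
`U(J)_w ⧸ Z_w(γ_w)` finite on compact sets with `μ_w{ȳ ∣ F_w(ȳ γ_w ȳ⁻¹) ≤ ρ} ≤ C ρ^a` (`ρ ≥ 1`, `a ≥ 0`).  Then `μ{ȳ Z(γ) ∣ ∏_w F_w((ȳ γ ȳ⁻¹)_w) ≤ R} ≤ A R^a (1 + log R)^m` for `R ≥ 1`
(★ `measure_setOf_descConj_le_of_pi_marginal_growth` along `archPiEquivCM⁻¹ : Π_w U(J)_w ≃* U(J)_∞`). [cite: BeuzartPlessis2020Asterisque, §1.5 (1.5.2) p. 31]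
[cite: Folland1995, §2.6 Thm. 2.49] [cite: Gelbart1975, p. 155 (10.19)] -/
theorem measure_setOf_descConj_prod_place_le_of_marginal_growth_arch
    (γ : ↥(UnitaryGroup.arch (↥(maximalRealSubfield L)) L (IsCMField.complexConj L) N J))
    [MeasurableSpace (↥(UnitaryGroup.arch (↥(maximalRealSubfield L)) L (IsCMField.complexConj L) N J) ⧸ Subgroup.centralizer ({γ} : Set _))]
    [BorelSpace (↥(UnitaryGroup.arch (↥(maximalRealSubfield L)) L (IsCMField.complexConj L) N J) ⧸ Subgroup.centralizer ({γ} : Set _))]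
    (μ : Measure (↥(UnitaryGroup.arch (↥(maximalRealSubfield L)) L (IsCMField.complexConj L) N J) ⧸ Subgroup.centralizer ({γ} : Set _)))
    [SMulInvariantMeasure ↥(UnitaryGroup.arch (↥(maximalRealSubfield L)) L (IsCMField.complexConj L) N J) _ μ] [IsFiniteMeasureOnCompacts μ]
    [∀ w : {w : InfinitePlace L // w.IsComplex}, MeasurableSpace (↥(archLocal L N J w) ⧸ Subgroup.centralizer ({archPiEquivCM N L J γ w} : Set _))]
    [∀ w : {w : InfinitePlace L // w.IsComplex}, BorelSpace (↥(archLocal L N J w) ⧸ Subgroup.centralizer ({archPiEquivCM N L J γ w} : Set _))]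
    (μw : ∀ w : {w : InfinitePlace L // w.IsComplex}, Measure (↥(archLocal L N J w) ⧸ Subgroup.centralizer ({archPiEquivCM N L J γ w} : Set _)))
    [∀ w, SMulInvariantMeasure ↥(archLocal L N J w) _ (μw w)] [∀ w, IsFiniteMeasureOnCompacts (μw w)] [∀ w, SigmaFinite (μw w)]
    (hμw : ∀ w, μw w ≠ 0)
    (F : ∀ w : {w : InfinitePlace L // w.IsComplex}, ↥(archLocal L N J w) → ℝ) (hF1 : ∀ w y, 1 ≤ F w y) {a : ℝ} (ha : 0 ≤ a)
    (hgrowth : ∀ w, ∃ C : ℝ, ∀ ρ : ℝ, 1 ≤ ρ →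
      μw w {x | descConj (archPiEquivCM N L J γ w) (Subgroup.centralizer ({archPiEquivCM N L J γ w} : Set _))
        (fun _ h => Subgroup.mem_centralizer_singleton_iff.1 h) (F w) x ≤ ρ} ≤ ENNReal.ofReal (C * ρ ^ a)) :
    ∃ (A : ℝ) (m : ℕ), ∀ R : ℝ, 1 ≤ R →
      μ {x | descConj γ (Subgroup.centralizer ({γ} : Set _)) (fun _ h => Subgroup.mem_centralizer_singleton_iff.1 h)
            (fun y => ∏ w, F w (archPiEquivCM N L J y w)) x ≤ R} ≤ ENNReal.ofReal (A * R ^ a * (1 + Real.log R) ^ m) := by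
  classical
  haveI : ∀ w : {w : InfinitePlace L // w.IsComplex}, SecondCountableTopology ↥(archLocal L N J w) := fun w => secondCountableTopology_archLocal L N _ w
  haveI : ∀ w : {w : InfinitePlace L // w.IsComplex}, LocallyCompactSpace ↥(archLocal L N J w) := fun w => locallyCompactSpace_archLocal L N _ w
  -- `e = archPiEquivCM⁻¹ : Π_w U(J)_w ≃* U(J)_∞`
  let e : (∀ w : {w : InfinitePlace L // w.IsComplex}, ↥(archLocal L N J w)) ≃* ↥(UnitaryGroup.arch (↥(maximalRealSubfield L)) L (IsCMField.complexConj L) N J) :=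
    (archPiEquivCM N L J).symm.toMulEquiv
  have heapply : ∀ b, e b = (archPiEquivCM N L J).symm b := fun _ => rfl
  have hesymm : ∀ y, e.symm y = archPiEquivCM N L J y := fun _ => rfl
  have hec : Continuous e := by
    have h : (⇑e) = fun b => (archPiEquivCM N L J).symm b := funext heapply
    rw [h]
    exact (archPiEquivCM N L J).symm.continuous
  have hes : Continuous e.symm := by
    have h : (⇑e.symm) = fun y => archPiEquivCM N L J y := funext hesymm
    rw [h]
    exact (archPiEquivCM N L J).continuous
  have hγ : e (fun w => archPiEquivCM N L J γ w) = γ := by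
    rw [heapply]
    exact (archPiEquivCM N L J).symm_apply_apply γ
  have hΦ : ∀ b : ∀ w : {w : InfinitePlace L // w.IsComplex}, ↥(archLocal L N J w),
      (fun y : ↥(UnitaryGroup.arch (↥(maximalRealSubfield L)) L (IsCMField.complexConj L) N J) => ∏ w, F w (archPiEquivCM N L J y w)) (e b) =
        ∏ w, F w (b w) := by
    intro b
    rw [heapply]
    simp only [ContinuousMulEquiv.apply_symm_apply]
  exact measure_setOf_descConj_le_of_pi_marginal_growth e hec hes hγ μ μw hμw
    (Φ := fun y : ↥(UnitaryGroup.arch (↥(maximalRealSubfield L)) L (IsCMField.complexConj L) N J) => ∏ w, F w (archPiEquivCM N L J y w))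
    (f := F) hΦ hF1 ha hgrowth

variable {N J} in
omit [NumberField L] [IsCMField L] in
/-- `N ≤ ‖y‖²_HS` on `U(σ_w J)(ℂ)` when `det J ≠ 0` (★ `mem_archLocal_iff_conjTranspose`, ★ `card_le_sum_normSq_of_conjTranspose_mul_mul_eq`), hence `1 ≤ ‖y‖²_HS` for `N ≥ 1`.
[cite: BeuzartPlessis2020Asterisque, §1.2 pp. 19–21] -/
theorem one_le_hs_archLocal [NeZero N] (hJ : J.det ≠ 0) (w : {w : InfinitePlace L // w.IsComplex}) (y : ↥(archLocal L N J w)) :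
    (1 : ℝ) ≤ ∑ i : Fin N, ∑ j : Fin N, ‖((y : GL (Fin N) ℂ) : Matrix (Fin N) (Fin N) ℂ) i j‖ ^ 2 := by
  have hmem := (mem_archLocal_iff_conjTranspose L N J w (y : GL (Fin N) ℂ)).1 y.2
  have hN : (1 : ℝ) ≤ N := by exact_mod_cast Nat.one_le_iff_ne_zero.2 (NeZero.ne N)
  exact hN.trans (card_le_sum_normSq_of_conjTranspose_mul_mul_eq (det_map_embedding_ne_zero L N hJ w) hmem)

variable {N J} in
/-- **THE HILBERT–SCHMIDT READING ON `U(J)_∞ ⧸ Z(γ)` = the `hvol` binder of ★ `integrable_descConj_of_archSchwartzOn_of_volumeGrowth` TOKEN FOR TOKEN.**  For `N ≥ 1`,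
`det J ≠ 0`, `γ ∈ U(J)(L⁺ ⊗ ℝ)`, ANY invariant `μ` on `U(J)_∞ ⧸ Z(γ)` finite on compact sets, and per complex place `w` ANY ONE non-zero invariant σ-finite `μ_w` on
`U(J)_w ⧸ Z_w(γ_w)` finite on compact sets whose orbit HS-balls grow polynomially, `μ_w{ȳ ∣ ‖ȳ γ_w ȳ⁻¹‖²_HS ≤ ρ} ≤ C ρ^a` (`ρ ≥ 1`), one has
`μ{ȳ Z(γ) ∣ archHSGL(ȳ γ ȳ⁻¹) ≤ R} ≤ A R^a (1 + log R)^m` for `R ≥ 1` (`archHSGL = ∏_w ‖·_w‖²_HS` by definition, place components read through ★ `coe_archPiEquivCM_apply`).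
At `N = 3`, `J = Φ₃` or `H`, `a = 1` this is the volume estimate behind the convergence of `𝒞(G_∞)`-orbital integrals of the LH2 letters, reduced to per-place statements.
[cite: BeuzartPlessis2020Asterisque, §1.5 (1.5.2)–(1.5.3) p. 31] [cite: Folland1995, §2.6 Thm. 2.49] -/
theorem measure_setOf_descConj_archHSGL_arch_le [NeZero N] (hJ : J.det ≠ 0)
    (γ : ↥(UnitaryGroup.arch (↥(maximalRealSubfield L)) L (IsCMField.complexConj L) N J))
    [MeasurableSpace (↥(UnitaryGroup.arch (↥(maximalRealSubfield L)) L (IsCMField.complexConj L) N J) ⧸ Subgroup.centralizer ({γ} : Set _))]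
    [BorelSpace (↥(UnitaryGroup.arch (↥(maximalRealSubfield L)) L (IsCMField.complexConj L) N J) ⧸ Subgroup.centralizer ({γ} : Set _))]
    (μ : Measure (↥(UnitaryGroup.arch (↥(maximalRealSubfield L)) L (IsCMField.complexConj L) N J) ⧸ Subgroup.centralizer ({γ} : Set _)))
    [SMulInvariantMeasure ↥(UnitaryGroup.arch (↥(maximalRealSubfield L)) L (IsCMField.complexConj L) N J) _ μ] [IsFiniteMeasureOnCompacts μ]
    [∀ w : {w : InfinitePlace L // w.IsComplex}, MeasurableSpace (↥(archLocal L N J w) ⧸ Subgroup.centralizer ({archPiEquivCM N L J γ w} : Set _))]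
    [∀ w : {w : InfinitePlace L // w.IsComplex}, BorelSpace (↥(archLocal L N J w) ⧸ Subgroup.centralizer ({archPiEquivCM N L J γ w} : Set _))]
    (μw : ∀ w : {w : InfinitePlace L // w.IsComplex}, Measure (↥(archLocal L N J w) ⧸ Subgroup.centralizer ({archPiEquivCM N L J γ w} : Set _)))
    [∀ w, SMulInvariantMeasure ↥(archLocal L N J w) _ (μw w)] [∀ w, IsFiniteMeasureOnCompacts (μw w)] [∀ w, SigmaFinite (μw w)]
    (hμw : ∀ w, μw w ≠ 0) {a : ℝ} (ha : 0 ≤ a)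
    (hplace : ∀ w, ∃ C : ℝ, ∀ ρ : ℝ, 1 ≤ ρ →
      μw w {x | descConj (archPiEquivCM N L J γ w) (Subgroup.centralizer ({archPiEquivCM N L J γ w} : Set _))
        (fun _ h => Subgroup.mem_centralizer_singleton_iff.1 h)
        (fun y : ↥(archLocal L N J w) => ∑ i : Fin N, ∑ j : Fin N, ‖((y : GL (Fin N) ℂ) : Matrix (Fin N) (Fin N) ℂ) i j‖ ^ 2) x ≤ ρ} ≤
        ENNReal.ofReal (C * ρ ^ a)) :
    ∃ (A : ℝ) (m : ℕ), ∀ R : ℝ, 1 ≤ R →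
      μ {x | descConj γ (Subgroup.centralizer ({γ} : Set _)) (fun _ h => Subgroup.mem_centralizer_singleton_iff.1 h)
            (fun y : ↥(UnitaryGroup.arch (↥(maximalRealSubfield L)) L (IsCMField.complexConj L) N J) =>
              archHSGL L N (y : GL (Fin N) (mixedSpace L))) x ≤ R} ≤ ENNReal.ofReal (A * R ^ a * (1 + Real.log R) ^ m) := by
  classical
  obtain ⟨A, m, hA⟩ := measure_setOf_descConj_prod_place_le_of_marginal_growth_arch L N J γ μ μw hμw
    (fun w (y : ↥(archLocal L N J w)) => ∑ i : Fin N, ∑ j : Fin N, ‖((y : GL (Fin N) ℂ) : Matrix (Fin N) (Fin N) ℂ) i j‖ ^ 2)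
    (fun w y => one_le_hs_archLocal L hJ w y) ha hplace
  refine ⟨A, m, fun R hR => ?_⟩
  have hset : {x | descConj γ (Subgroup.centralizer ({γ} : Set _)) (fun _ h => Subgroup.mem_centralizer_singleton_iff.1 h)
            (fun y : ↥(UnitaryGroup.arch (↥(maximalRealSubfield L)) L (IsCMField.complexConj L) N J) =>
              archHSGL L N (y : GL (Fin N) (mixedSpace L))) x ≤ R} =
      {x | descConj γ (Subgroup.centralizer ({γ} : Set _)) (fun _ h => Subgroup.mem_centralizer_singleton_iff.1 h)
            (fun y => ∏ w, (∑ i : Fin N, ∑ j : Fin N, ‖(((archPiEquivCM N L J y w : ↥(archLocal L N J w)) : GL (Fin N) ℂ) : Matrix (Fin N) (Fin N) ℂ) i j‖ ^ 2)) x ≤ R} := by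
    ext x
    induction x using QuotientGroup.induction_on with
    | H y =>
      simp only [Set.mem_setOf_eq, descConj_mk]
      unfold archHSGL
      rfl
  rw [hset]
  exact hA R hR

end Quotient

/-! ## §2 The group side on `U(J)(L⁺ ⊗ ℝ)`: any Haar measure, per-place Haar growth -/

section Group

variable (L : Type) [Field L] [NumberField L] [IsCMField L] (N : ℕ) (J : Matrix (Fin N) (Fin N) L)

/-- **«PLACES MULTIPLY» ON `U(J)_∞` (any Haar measure)** — the `U(J)`-twin of ★ `haar_setOf_prod_place_le_of_marginal_growth` (which is `H_∞ = U(Φ₂)_∞ × U(Φ₁)_∞`).  Let `F_w ≥ 1` be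
functions on the place carriers `U(J)_w` (★ `archLocal L N J w`) whose Haar sub-level sets grow like `ν{F_w ≤ ρ} ≤ C ρ^a` (`ρ ≥ 1`, every Haar `ν`; `a ≥ 0`).  Then for every Haar
measure `ν_G` on `U(J)(L⁺ ⊗ ℝ)` there are `A, m` with `ν_G{k ∣ ∏_w F_w(k_w) ≤ R} ≤ A R^a (1 + log R)^m` for `R ≥ 1` (`k_w = archPiEquivCM … k w`): transport along ★ `archPiEquivCM`,
Haar uniqueness (`isMulLeftInvariant_eq_smul`), product Haar = Haar, and ★ `exists_pi_measure_setOf_prod_le_of_marginal_growth`. [cite: BeuzartPlessis2020Asterisque, §1.5 (1.5.2) p. 31]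
[cite: Folland1995, §2.6 Thm. 2.49] [cite: PlatonovRapinchuk1994, §3.2] -/
theorem haar_setOf_prod_place_le_of_marginal_growth_arch
    [MeasurableSpace ↥(UnitaryGroup.arch (↥(maximalRealSubfield L)) L (IsCMField.complexConj L) N J)]
    [BorelSpace ↥(UnitaryGroup.arch (↥(maximalRealSubfield L)) L (IsCMField.complexConj L) N J)]
    (νG : Measure ↥(UnitaryGroup.arch (↥(maximalRealSubfield L)) L (IsCMField.complexConj L) N J)) [νG.IsHaarMeasure]
    [∀ w : {w : InfinitePlace L // w.IsComplex}, MeasurableSpace ↥(archLocal L N J w)]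
    [∀ w : {w : InfinitePlace L // w.IsComplex}, BorelSpace ↥(archLocal L N J w)]
    (F : ∀ w : {w : InfinitePlace L // w.IsComplex}, ↥(archLocal L N J w) → ℝ) (hF1 : ∀ w y, 1 ≤ F w y) {a : ℝ} (ha : 0 ≤ a)
    (hgrowth : ∀ (w : {w : InfinitePlace L // w.IsComplex}) (ν : Measure ↥(archLocal L N J w)) [ν.IsHaarMeasure],
      ∃ C : ℝ, ∀ ρ : ℝ, 1 ≤ ρ → ν {y | F w y ≤ ρ} ≤ ENNReal.ofReal (C * ρ ^ a)) :
    ∃ (A : ℝ) (m : ℕ), ∀ R : ℝ, 1 ≤ R →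
      νG {k | ∏ w, F w (archPiEquivCM N L J k w) ≤ R} ≤ ENNReal.ofReal (A * R ^ a * (1 + Real.log R) ^ m) := by
  classical
  -- topological instances on the factors and on `U(J)_∞`
  haveI : ∀ w : {w : InfinitePlace L // w.IsComplex}, SecondCountableTopology ↥(archLocal L N J w) := fun w => secondCountableTopology_archLocal L N _ w
  haveI : ∀ w : {w : InfinitePlace L // w.IsComplex}, LocallyCompactSpace ↥(archLocal L N J w) := fun w => locallyCompactSpace_archLocal L N _ w
  haveI := locallyCompactSpace_mixedSpaceGL L N
  haveI := secondCountableTopology_mixedSpaceGL L N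
  haveI : LocallyCompactSpace ↥(UnitaryGroup.arch (↥(maximalRealSubfield L)) L (IsCMField.complexConj L) N J) :=
    (UnitaryGroup.isClosed_arch (↥(maximalRealSubfield L)) L (IsCMField.complexConj L) N _).isClosedEmbedding_subtypeVal.locallyCompactSpace
  haveI : SecondCountableTopology ↥(UnitaryGroup.arch (↥(maximalRealSubfield L)) L (IsCMField.complexConj L) N J) :=
    Topology.IsEmbedding.subtypeVal.secondCountableTopology
  -- the Haar measures on the model and its transport along `archPiEquivCM⁻¹`
  set ν : ∀ w : {w : InfinitePlace L // w.IsComplex}, Measure ↥(archLocal L N J w) := fun w => Measure.haar with hν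
  haveI : (Measure.pi ν).IsHaarMeasure := inferInstance
  set e := archPiEquivCM N L J with he
  set μG : Measure ↥(UnitaryGroup.arch (↥(maximalRealSubfield L)) L (IsCMField.complexConj L) N J) := Measure.map e.symm (Measure.pi ν) with hμG
  haveI : μG.IsHaarMeasure := by
    rw [hμG]
    exact e.symm.isHaarMeasure_map (Measure.pi ν)
  -- Haar uniqueness
  have hνG : νG = haarScalarFactor νG μG • μG := isMulLeftInvariant_eq_smul νG μG
  -- the dyadic-box bound on the model
  obtain ⟨A, m, hA0, hA⟩ := exists_pi_measure_setOf_prod_le_of_marginal_growth ν hF1 ha (fun w => hgrowth w (ν w))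
  refine ⟨(haarScalarFactor νG μG : ℝ) * A, m, fun R hR => ?_⟩
  set S : Set ↥(UnitaryGroup.arch (↥(maximalRealSubfield L)) L (IsCMField.complexConj L) N J) := {k | ∏ w, F w (e k w) ≤ R} with hS
  have hpre : e.symm ⁻¹' S = {y : ∀ w : {w : InfinitePlace L // w.IsComplex}, ↥(archLocal L N J w) | ∏ w, F w (y w) ≤ R} := by
    ext y
    simp only [Set.mem_preimage, hS, Set.mem_setOf_eq, ContinuousMulEquiv.apply_symm_apply]
  have hmap : μG S = (Measure.pi ν) (e.symm ⁻¹' S) := by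
    rw [hμG, show (⇑e.symm : _ → _) = ⇑e.symm.toHomeomorph.toMeasurableEquiv from rfl, MeasurableEquiv.map_apply]
  have hX0 : 0 ≤ A * R ^ a * (1 + Real.log R) ^ m :=
    mul_nonneg (mul_nonneg hA0 (Real.rpow_nonneg (zero_le_one.trans hR) a)) (pow_nonneg (by linarith [Real.log_nonneg hR]) m)
  have hc : ((haarScalarFactor νG μG : ℝ≥0) : ℝ≥0∞) = ENNReal.ofReal (haarScalarFactor νG μG : ℝ) := ENNReal.ofReal_coe_nnreal.symm
  calc νG S = (haarScalarFactor νG μG • μG) S := by rw [← hνG]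
    _ = haarScalarFactor νG μG * μG S := by rw [Measure.coe_nnreal_smul_apply]
    _ = haarScalarFactor νG μG * (Measure.pi ν) {y | ∏ w, F w (y w) ≤ R} := by rw [hmap, hpre]
    _ ≤ haarScalarFactor νG μG * ENNReal.ofReal (A * R ^ a * (1 + Real.log R) ^ m) := by
        gcongr
        exact hA R hR
    _ = ENNReal.ofReal ((haarScalarFactor νG μG : ℝ) * A * R ^ a * (1 + Real.log R) ^ m) := by
        rw [hc, ← ENNReal.ofReal_mul (NNReal.coe_nonneg _)]
        congr 1
        ring

variable {N J} in
/-- **THE GROUP-SIDE HILBERT–SCHMIDT READING ON `U(J)_∞`**: for `N ≥ 1`, `det J ≠ 0` and ANY Haar measure `ν_G` on `U(J)(L⁺ ⊗ ℝ)`, if at each complex place EVERY Haar measure of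
`U(J)_w` gives its HS-balls polynomial growth `ν{y ∣ ‖y‖²_HS ≤ ρ} ≤ C ρ^a` (`ρ ≥ 1`), then `ν_G{k ∣ archHSGL k ≤ R} ≤ A R^a (1 + log R)^m` for `R ≥ 1` (`archHSGL = ∏_w ‖·_w‖²_HS`).
At `N = 3`, `J = Φ₃`, `a = 2` this is the group-side input of the elliptic (VOL) chain on `G_∞ = U(2,1)^d`. [cite: BeuzartPlessis2020Asterisque, §1.5 (1.5.2) p. 31]
[cite: Folland1995, §2.6 Thm. 2.49] -/
theorem haar_setOf_archHSGL_arch_le [NeZero N] (hJ : J.det ≠ 0)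
    [MeasurableSpace ↥(UnitaryGroup.arch (↥(maximalRealSubfield L)) L (IsCMField.complexConj L) N J)]
    [BorelSpace ↥(UnitaryGroup.arch (↥(maximalRealSubfield L)) L (IsCMField.complexConj L) N J)]
    (νG : Measure ↥(UnitaryGroup.arch (↥(maximalRealSubfield L)) L (IsCMField.complexConj L) N J)) [νG.IsHaarMeasure]
    {a : ℝ} (ha : 0 ≤ a)
    (hgrowth : ∀ (w : {w : InfinitePlace L // w.IsComplex}) [MeasurableSpace ↥(archLocal L N J w)] [BorelSpace ↥(archLocal L N J w)]
      (ν : Measure ↥(archLocal L N J w)) [ν.IsHaarMeasure],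
      ∃ C : ℝ, ∀ ρ : ℝ, 1 ≤ ρ →
        ν {y | ∑ i : Fin N, ∑ j : Fin N, ‖((y : GL (Fin N) ℂ) : Matrix (Fin N) (Fin N) ℂ) i j‖ ^ 2 ≤ ρ} ≤ ENNReal.ofReal (C * ρ ^ a)) :
    ∃ (A : ℝ) (m : ℕ), ∀ R : ℝ, 1 ≤ R →
      νG {k | archHSGL L N (k : GL (Fin N) (mixedSpace L)) ≤ R} ≤ ENNReal.ofReal (A * R ^ a * (1 + Real.log R) ^ m) := by
  classical
  letI mU : ∀ w : {w : InfinitePlace L // w.IsComplex}, MeasurableSpace ↥(archLocal L N J w) := fun _ => borel _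
  haveI : ∀ w : {w : InfinitePlace L // w.IsComplex}, BorelSpace ↥(archLocal L N J w) := fun _ => ⟨rfl⟩
  obtain ⟨A, m, hA⟩ := haar_setOf_prod_place_le_of_marginal_growth_arch L N J νG
    (fun w (y : ↥(archLocal L N J w)) => ∑ i : Fin N, ∑ j : Fin N, ‖((y : GL (Fin N) ℂ) : Matrix (Fin N) (Fin N) ℂ) i j‖ ^ 2)
    (fun w y => one_le_hs_archLocal L hJ w y) ha (fun w ν _ => hgrowth w ν)
  refine ⟨A, m, fun R hR => ?_⟩
  have hset : {k : ↥(UnitaryGroup.arch (↥(maximalRealSubfield L)) L (IsCMField.complexConj L) N J) | archHSGL L N (k : GL (Fin N) (mixedSpace L)) ≤ R} =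
      {k | ∏ w, (∑ i : Fin N, ∑ j : Fin N, ‖(((archPiEquivCM N L J k w : ↥(archLocal L N J w)) : GL (Fin N) ℂ) : Matrix (Fin N) (Fin N) ℂ) i j‖ ^ 2) ≤ R} := by
    ext k
    rw [Set.mem_setOf_eq, Set.mem_setOf_eq]
    unfold archHSGL
    rfl
  rw [hset]
  exact hA R hR

end Group

end Literature.NumberTheory.Rogawski1990

end
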